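import Literature.Analysis.Calculus.SardProofs
import Mathlib.Geometry.Manifold.MFDeriv.Atlas
import Mathlib.Geometry.Manifold.MFDeriv.NormedSpace
import Mathlib.Geometry.Manifold.ContMDiff.Atlas
import Mathlib.Geometry.Manifold.Instances.Real
import Mathlib.MeasureTheory.Measure.Haar.InnerProductSpace
import Mathlib.MeasureTheory.Measure.OpenPos
import HarnessLib

/-!
# Sard's theorem for maps from manifolds to `ℝᵇ` (any dimensions): critical values are null,
# regular values are dense

General differential topology (Milnor, *Topology from the Differentiable Viewpoint* (1965), §2
p. 10 and §3 p. 16: *"Sard's theorem applies to maps of manifolds by using coordinate charts: if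
`f : M → N` is smooth and `C` its critical set, `f(C)` has measure zero"*; Brown's corollary
p. 17: the regular values are dense). The tree has the Euclidean theorem in all dimensions
(`Literature.Analysis.Calculus.sard_holds`: maps between Euclidean spaces, `C^∞` on an open
set), its transfer to manifolds in EQUAL dimensions (`Literature/Analysis/Calculus/SardManifold.lean`)
and for REAL-valued functions (`RegularValuesReal.lean`). This file records the general case
consumed by transversality arguments (parametric transversality, general position of
immersions): for `u : M → ℝᵇ` of class `C^∞` on an open set `U` of a `C^∞` manifold `M` modelled
on `ℝᵐ` (second countable), with critical point = `du_x` not onto,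

* `volume_image_not_surjective_chart_eq_zero` — over one extended chart the critical values in
  `U` are Lebesgue-null (Sard for `u ∘ φ⁻¹` on the open set `φ.target ∩ φ⁻¹(U) ⊆ ℝᵐ`; a regular
  point of `u ∘ φ⁻¹` is a regular point of `u` since `d(u ∘ φ⁻¹) = du ∘ dφ⁻¹`);
* `volume_image_setOf_not_surjective_mfderiv_eq_zero` — **Sard**: `u(critical points in U)` is
  null (countably many charts);
* `dense_compl_of_volume_eq_zero` — a Lebesgue-null subset of `ℝᵇ` has dense complement;
* `dense_setOf_regularValue` — **Brown**: the regular values of `u|U` are dense in `ℝᵇ`.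

Everything is proved; no definitions, no named facts.

## References

* J. Milnor, *Topology from the Differentiable Viewpoint* (1965), §2, §3 (Theorem of Sard and
  Brown's corollary, pp. 10–11, 16–17). [MilnorTDV1965]
* M. W. Hirsch, *Differential Topology* (1976), Ch. 3 §1, Thm. 1.3 (Morse–Sard for manifolds).
  [HirschDT1976]
-/

noncomputable section

open Set Function MeasureTheory Filter
open scoped Manifold ContDiff Topology

namespace Literature.Geometry.Manifold

/-- Local notation: `𝔼 n` is the model Euclidean space `EuclideanSpace ℝ (Fin n)`. -/
local notation "𝔼 " n:arg => EuclideanSpace ℝ (Fin n)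

variable {m b : ℕ} {M : Type*} [TopologicalSpace M] [ChartedSpace (𝔼 m) M]
  [IsManifold (𝓡 m) ∞ M] {u : M → 𝔼 b} {U : Set M}

/-- **Critical values over one chart are null** (any dimensions). For `u : M → ℝᵇ` of class
`C^∞` on the open set `U` and `x₀ ∈ M`, the set of values of `u` at points of
`U ∩ (source of the extended chart at x₀)` where `du_x` is not onto is Lebesgue-null: it lies
in the set of critical values of `u ∘ φ⁻¹` on the open set `φ.target ∩ φ⁻¹(U) ⊆ ℝᵐ`
(`Literature.Analysis.Calculus.sard_holds`). [cite: MilnorTDV1965, §3, Theorem p. 16] -/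
theorem volume_image_not_surjective_chart_eq_zero (hU : IsOpen U)
    (hu : ContMDiffOn (𝓡 m) (𝓡 b) ∞ u U) (x₀ : M) :
    volume (u '' {x ∈ U ∩ (extChartAt (𝓡 m) x₀).source |
      ¬ Surjective (mfderiv (𝓡 m) (𝓡 b) u x)}) = 0 := by
  set φ := extChartAt (𝓡 m) x₀ with hφ
  have hTo : IsOpen (φ.target ∩ φ.symm ⁻¹' U) :=
    (continuousOn_extChartAt_symm x₀).isOpen_inter_preimage (isOpen_extChartAt_target x₀) hU
  -- smoothness of `u ∘ φ⁻¹` on `φ.target ∩ φ⁻¹ U`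
  have hsymm : ContMDiffOn 𝓘(ℝ, 𝔼 m) (𝓡 m) ∞ φ.symm (φ.target ∩ φ.symm ⁻¹' U) :=
    (contMDiffOn_extChartAt_symm x₀).mono inter_subset_left
  have hgs : ContMDiffOn 𝓘(ℝ, 𝔼 m) (𝓡 b) ∞ (u ∘ φ.symm) (φ.target ∩ φ.symm ⁻¹' U) :=
    hu.comp hsymm fun z hz => hz.2
  have hgs' : ContDiffOn ℝ ∞ (u ∘ φ.symm) (φ.target ∩ φ.symm ⁻¹' U) :=
    contMDiffOn_iff_contDiffOn.1 hgs
  -- Sard for `u ∘ φ⁻¹`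
  have hS := Literature.Analysis.Calculus.sard_holds (u ∘ φ.symm) _ hTo hgs'
  -- the critical values of `u` over the chart are critical values of `u ∘ φ⁻¹`
  have hsub : u '' {x ∈ U ∩ φ.source | ¬ Surjective (mfderiv (𝓡 m) (𝓡 b) u x)} ⊆
      (u ∘ φ.symm) '' {z ∈ φ.target ∩ φ.symm ⁻¹' U |
        ¬ Surjective (fderiv ℝ (u ∘ φ.symm) z)} := by
    rintro _ ⟨x, ⟨⟨hxU, hx⟩, hdx⟩, rfl⟩
    have hz : φ x ∈ φ.target := φ.map_source hx
    have hzT : φ x ∈ φ.target ∩ φ.symm ⁻¹' U :=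
      ⟨hz, by show φ.symm (φ x) ∈ U; rwa [φ.left_inv hx]⟩
    refine ⟨φ x, ⟨hzT, fun hsurj => hdx ?_⟩, by show u (φ.symm (φ x)) = u x; rw [φ.left_inv hx]⟩
    -- `d(u ∘ φ⁻¹) (φ x) = du ∘ d(φ⁻¹)`, so `du` is onto at `φ⁻¹ (φ x) = x` if `d(u ∘ φ⁻¹)` is
    have hsymm_d : MDifferentiableAt 𝓘(ℝ, 𝔼 m) (𝓡 m) φ.symm (φ x) :=
      (hsymm.mdifferentiableOn (by simp) _ hzT).mdifferentiableAt (hTo.mem_nhds hzT)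
    have hux : MDifferentiableAt (𝓡 m) (𝓡 b) u (φ.symm (φ x)) := by
      have h := (hu.mdifferentiableOn (by simp) x hxU).mdifferentiableAt (hU.mem_nhds hxU)
      rwa [← φ.left_inv hx] at h
    have hcomp := mfderiv_comp (φ x) hux hsymm_d
    have hfun : (fderiv ℝ (u ∘ φ.symm) (φ x) : 𝔼 m → 𝔼 b) =
        (mfderiv (𝓡 m) (𝓡 b) u (φ.symm (φ x))) ∘ (mfderiv 𝓘(ℝ, 𝔼 m) (𝓡 m) φ.symm (φ x)) := by
      have h1 : fderiv ℝ (u ∘ φ.symm) (φ x) = mfderiv 𝓘(ℝ, 𝔼 m) (𝓡 b) (u ∘ φ.symm) (φ x) :=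
        mfderiv_eq_fderiv.symm
      rw [h1, hcomp]
      rfl
    have key : Surjective (mfderiv (𝓡 m) (𝓡 b) u (φ.symm (φ x))) := by
      rw [hfun] at hsurj
      exact hsurj.of_comp
    rwa [φ.left_inv hx] at key
  exact measure_mono_null hsub hS

/-- **Sard's theorem for `u : M → ℝᵇ` (any dimensions)**: the set of critical values of `u` on
the open set `U` — values `u x`, `x ∈ U`, with `du_x` not onto — is Lebesgue-null.
[cite: MilnorTDV1965, §3, Theorem p. 16; HirschDT1976, Ch. 3 Thm. 1.3] -/
theorem volume_image_setOf_not_surjective_mfderiv_eq_zero [SecondCountableTopology M]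
    (hU : IsOpen U) (hu : ContMDiffOn (𝓡 m) (𝓡 b) ∞ u U) :
    volume (u '' {x ∈ U | ¬ Surjective (mfderiv (𝓡 m) (𝓡 b) u x)}) = 0 := by
  obtain ⟨t, htc, ht⟩ := TopologicalSpace.countable_cover_nhds
    (fun x : M => extChartAt_source_mem_nhds (I := 𝓡 m) x)
  have hsub : u '' {x ∈ U | ¬ Surjective (mfderiv (𝓡 m) (𝓡 b) u x)} ⊆
      ⋃ x₀ ∈ t, u '' {x ∈ U ∩ (extChartAt (𝓡 m) x₀).source |
        ¬ Surjective (mfderiv (𝓡 m) (𝓡 b) u x)} := by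
    rintro _ ⟨x, ⟨hxU, hdx⟩, rfl⟩
    have hx : x ∈ ⋃ x₀ ∈ t, (extChartAt (𝓡 m) x₀).source := by
      rw [ht]
      exact mem_univ x
    obtain ⟨x₀, hx₀, hx'⟩ := mem_iUnion₂.1 hx
    exact mem_iUnion₂.2 ⟨x₀, hx₀, x, ⟨⟨hxU, hx'⟩, hdx⟩, rfl⟩
  exact measure_mono_null hsub ((measure_biUnion_null_iff htc).2 fun x₀ _ =>
    volume_image_not_surjective_chart_eq_zero hU hu x₀)

omit [IsManifold (𝓡 m) ∞ M] in
/-- A Lebesgue-null subset of `ℝᵇ` has dense complement. [folklore] -/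
theorem dense_compl_of_volume_eq_zero {s : Set (𝔼 b)} (hs : volume s = 0) : Dense sᶜ := by
  rw [dense_iff_inter_open]
  intro O hO hne
  by_contra h
  have hsub : O ⊆ s := fun x hx => by
    by_contra hx'
    exact h ⟨x, hx, hx'⟩
  exact (hO.measure_pos volume hne).ne' (measure_mono_null hsub hs)

/-- **Brown's corollary: regular values are dense.** For `u : M → ℝᵇ` of class `C^∞` on the
open set `U`, the values `y` such that `du_x` is onto at every `x ∈ U` with `u x = y` form a
dense subset of `ℝᵇ`. [cite: MilnorTDV1965, §3, Corollary (Brown) p. 17] -/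
theorem dense_setOf_regularValue [SecondCountableTopology M] (hU : IsOpen U)
    (hu : ContMDiffOn (𝓡 m) (𝓡 b) ∞ u U) :
    Dense {y : 𝔼 b | ∀ x ∈ U, u x = y → Surjective (mfderiv (𝓡 m) (𝓡 b) u x)} := by
  have h := dense_compl_of_volume_eq_zero
    (volume_image_setOf_not_surjective_mfderiv_eq_zero hU hu)
  refine h.mono fun y hy x hxU hux => ?_
  by_contra hdx
  exact hy ⟨x, ⟨hxU, hdx⟩, hux⟩

end Literature.Geometry.Manifold
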